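import Summits.RiemannHypothesis.RiemannHypothesis.Theorems.WeilFormatCPolyFourier
import Literature.NumberTheory.LFunctions.YoshidaWindowSpaces
import HarnessLib

/-!
# Format C, design C∞ (L2 backbone): cubic decay of the window Fourier coefficients of a `C¹`-periodising window

Route context: Fourier–Galerkin / Schur-complement certificates of Weil positivity on a window ("format C";
cell memo `run/shared/lean/pub/rh-explicit/rh-explicit-weil-10/FORMATC-DESIGN.md` §9.12.11; supporting
stmt-RiemannHypothesis-0098; seat rh-explicit-weil-10).  The deflation profiles of design C∞ are window polynomials `p·𝟙_{[−a,a]}`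
with `p(−a) = p(a)` and `p′(−a) = p′(a)` (measured to carry the whole cost factor, §9.12.11).  The sesquilinear dictionary
`WeilFormatCWindowPolarization.tendsto_weilWindowSesq_proj_of_summable` asks for `Σ|c_n| < ∞` and `Σ|n||c_n| < ∞`; this file
supplies them from TWO matching boundary data by partial integration with boundary terms (Yoshida's (3.1) argument, which the
tree states only for PERIODIC smooth `f`, `YoshidaWindowFourierDecay.integral_mul_cexp_eq_deriv`):

* `integral_mul_cexp_parts` — `∫_a^b f e^{cx} = (f(b)e^{cb} − f(a)e^{ca})/c − c^{-1}∫_a^b f′ e^{cx}` (`c ≠ 0`);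
* `fourierCoeff_eq_boundary_add_deriv` — on the window with `c = −iπn/a`: `c_n(f) = (a/(iπn))·((−1)^n (f(−a) − f(a)) + c_n(f′))`;
* `norm_fourierCoeff_le_of_deriv` — `|c_n(f)| ≤ (a/(π|n|))·(|f(a)| + |f(−a)| + ∫|f′|)`;
* `norm_fourierCoeff_le_cube` — `f(±a)`, `f′(±a)` matching ⟹ `|c_n(f)| ≤ (a/(π|n|))³ (|f″(a)| + |f″(−a)| + ∫|f‴|)`;
* `summable_pow_mul_norm_of_le_div_pow` — `|c_n| ≤ C/|n|^{j+2}` ⟹ `Σ |n|^j |c_n| < ∞`;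
* `fourierCoeff_ofReal_pow_eq_sum` — the closed-form coefficients of the monomial windows in the tree's convention (bridge to PolyFourier).

Elementary calculus; standard axioms; no RH claim.
-/

set_option autoImplicit false
-- `Summit.RiemannHypothesis.RiemannHypothesis.…` is the layout-mandated namespace (summit = problem name).
set_option linter.dupNamespace false

noncomputable section

open Complex MeasureTheory intervalIntegral Set Filter
open scoped Real Interval Topology

namespace Summit.RiemannHypothesis.RiemannHypothesis.Theorems.WeilFormatC

open Literature.NumberTheory.LFunctions

/-- **Integration by parts against an exponential**: for `c ≠ 0`, `f` with a continuous derivative `f′`,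
`∫_a^b f(x) e^{cx} dx = (f(b)e^{cb} − f(a)e^{ca})/c − c^{-1} ∫_a^b f′(x) e^{cx} dx`. -/
theorem integral_mul_cexp_parts {c : ℂ} (hc : c ≠ 0) {f f' : ℝ → ℂ} (hf : ∀ x, HasDerivAt f (f' x) x)
    (hf' : Continuous f') (a b : ℝ) :
    ∫ x in a..b, f x * Complex.exp (c * x)
      = (f b * Complex.exp (c * b) - f a * Complex.exp (c * a)) / c - c⁻¹ * ∫ x in a..b, f' x * Complex.exp (c * x) := by
  have hv : ∀ x ∈ [[a, b]], HasDerivAt (fun y : ℝ ↦ Complex.exp (c * y) / c) (Complex.exp (c * x)) x :=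
    fun x _ ↦ hasDerivAt_cexp_mul_div c hc x
  have hfc : Continuous f := continuous_iff_continuousAt.2 fun x ↦ (hf x).continuousAt
  have hu' : IntervalIntegrable f' volume a b := hf'.intervalIntegrable _ _
  have hv' : IntervalIntegrable (fun x : ℝ ↦ Complex.exp (c * x)) volume a b := by
    apply Continuous.intervalIntegrable
    fun_prop
  have key := integral_mul_deriv_eq_deriv_mul (fun x _ ↦ hf x) hv hu' hv'
  rw [key]
  have e : ∫ x in a..b, f' x * (Complex.exp (c * x) / c) = c⁻¹ * ∫ x in a..b, f' x * Complex.exp (c * x) := by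
    rw [← intervalIntegral.integral_const_mul]
    refine intervalIntegral.integral_congr fun x _ ↦ ?_
    field_simp
  rw [e]
  field_simp

variable {a : ℝ}

/-- The window Fourier coefficient written with the exponential `e^{cx}`, `c = −iπn/a`. -/
theorem fourierCoeff_eq_integral_mul_cexp (a : ℝ) (n : ℤ) (φ : ℝ → ℂ) :
    Yoshida1992.fourierCoeff a n φ = ∫ x in (-a)..a, φ x * Complex.exp (-(π * I * n / a) * x) := by
  unfold Yoshida1992.fourierCoeff
  refine intervalIntegral.integral_congr fun x _ ↦ ?_
  congr 2
  ring

/-- The window phases: `e^{−iπn} = e^{iπn} = (−1)^n`, in the form `e^{c·(±a)}` with `c = −iπn/a` (`a ≠ 0`). -/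
theorem cexp_window_phase (ha : a ≠ 0) (n : ℤ) :
    Complex.exp (-(π * I * n / a) * a) = (-1 : ℂ) ^ n ∧ Complex.exp (-(π * I * n / a) * (((-a : ℝ)) : ℂ)) = (-1 : ℂ) ^ n := by
  have ha' : (a : ℂ) ≠ 0 := by exact_mod_cast ha
  constructor
  · have h : (-(π * I * n / a) * a : ℂ) = (-n : ℤ) * (π * I) := by
      push_cast
      field_simp
    rw [h, Complex.exp_int_mul, Complex.exp_pi_mul_I, zpow_neg, ← inv_zpow, inv_neg, inv_one]
  · have h : (-(π * I * n / a) * (((-a : ℝ)) : ℂ) : ℂ) = (n : ℂ) * (π * I) := by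
      push_cast
      field_simp
    rw [h, Complex.exp_int_mul, Complex.exp_pi_mul_I]

/-- **Partial integration with boundary term on the window**: for `a ≠ 0`, `n ≠ 0` and `f` with continuous derivative `f′`,
`c_n(f) = (a/(iπn))·((−1)^n (f(−a) − f(a)) + c_n(f′))`. -/
theorem fourierCoeff_eq_boundary_add_deriv (ha : a ≠ 0) {n : ℤ} (hn : n ≠ 0) {f f' : ℝ → ℂ}
    (hf : ∀ x, HasDerivAt f (f' x) x) (hf' : Continuous f') :
    Yoshida1992.fourierCoeff a n f
      = (a / (π * I * n)) * ((-1 : ℂ) ^ n * (f (-a) - f a) + Yoshida1992.fourierCoeff a n f') := by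
  have hc : (-(π * I * n / a) : ℂ) ≠ 0 := by
    have ha' : (a : ℂ) ≠ 0 := by exact_mod_cast ha
    have hn' : (n : ℂ) ≠ 0 := by exact_mod_cast hn
    have hπ : (π : ℂ) ≠ 0 := by exact_mod_cast Real.pi_ne_zero
    exact neg_ne_zero.2 (div_ne_zero (mul_ne_zero (mul_ne_zero hπ I_ne_zero) hn') ha')
  obtain ⟨h1, h2⟩ := cexp_window_phase ha n
  rw [fourierCoeff_eq_integral_mul_cexp, fourierCoeff_eq_integral_mul_cexp, integral_mul_cexp_parts hc hf hf' (-a) a, h1, h2]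
  have ha' : (a : ℂ) ≠ 0 := by exact_mod_cast ha
  have hn' : (n : ℂ) ≠ 0 := by exact_mod_cast hn
  have hπ : (π : ℂ) ≠ 0 := by exact_mod_cast Real.pi_ne_zero
  field_simp
  ring

/-- **First-derivative bound**: `|c_n(f)| ≤ (a/(π|n|))·(|f(a)| + |f(−a)| + ∫_{−a}^{a}|f′|)` (`a > 0`, `n ≠ 0`). -/
theorem norm_fourierCoeff_le_of_deriv (ha : 0 < a) {n : ℤ} (hn : n ≠ 0) {f f' : ℝ → ℂ}
    (hf : ∀ x, HasDerivAt f (f' x) x) (hf' : Continuous f') :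
    ‖Yoshida1992.fourierCoeff a n f‖ ≤ (a / (π * |(n : ℝ)|)) * (‖f a‖ + ‖f (-a)‖ + ∫ x in (-a)..a, ‖f' x‖) := by
  rw [fourierCoeff_eq_boundary_add_deriv ha.ne' hn hf hf']
  have hnorm1 : ‖(a / (π * I * n) : ℂ)‖ = a / (π * |(n : ℝ)|) := by
    rw [norm_div, Complex.norm_real, Real.norm_of_nonneg ha.le, norm_mul, norm_mul, Complex.norm_real,
      Real.norm_of_nonneg Real.pi_pos.le, Complex.norm_I, mul_one, Complex.norm_intCast]
  have hint : ‖Yoshida1992.fourierCoeff a n f'‖ ≤ ∫ x in (-a)..a, ‖f' x‖ := by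
    unfold Yoshida1992.fourierCoeff
    refine (intervalIntegral.norm_integral_le_integral_norm (by linarith)).trans (le_of_eq ?_)
    refine intervalIntegral.integral_congr fun x _ ↦ ?_
    simp only [norm_mul]
    rw [show (-(π * I * n * x / a) : ℂ) = ((-(π * n * x / a) : ℝ) : ℂ) * I by push_cast; ring,
      Complex.norm_exp_ofReal_mul_I, mul_one]
  rw [norm_mul, hnorm1]
  refine mul_le_mul_of_nonneg_left ?_ (by positivity)
  calc ‖(-1 : ℂ) ^ n * (f (-a) - f a) + Yoshida1992.fourierCoeff a n f'‖
      ≤ ‖(-1 : ℂ) ^ n * (f (-a) - f a)‖ + ‖Yoshida1992.fourierCoeff a n f'‖ := norm_add_le _ _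
    _ ≤ (‖f a‖ + ‖f (-a)‖) + ∫ x in (-a)..a, ‖f' x‖ := by
        refine add_le_add ?_ hint
        rw [norm_mul, norm_zpow, norm_neg, norm_one, one_zpow, one_mul]
        exact (norm_sub_le _ _).trans (by rw [add_comm])

/-- **Cubic decay from two matching boundary data.**  If `f` has three continuous derivatives `f₁, f₂, f₃`,
`f(−a) = f(a)` and `f₁(−a) = f₁(a)` (`a > 0`), then for `n ≠ 0`
`|c_n(f)| ≤ (a/(π|n|))³ · (|f₂(a)| + |f₂(−a)| + ∫_{−a}^{a}|f₃|)`. -/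
theorem norm_fourierCoeff_le_cube (ha : 0 < a) {n : ℤ} (hn : n ≠ 0) {f f₁ f₂ f₃ : ℝ → ℂ}
    (h₀ : ∀ x, HasDerivAt f (f₁ x) x) (h₁ : ∀ x, HasDerivAt f₁ (f₂ x) x) (h₂ : ∀ x, HasDerivAt f₂ (f₃ x) x)
    (hf₃ : Continuous f₃) (he₀ : f (-a) = f a) (he₁ : f₁ (-a) = f₁ a) :
    ‖Yoshida1992.fourierCoeff a n f‖
      ≤ (a / (π * |(n : ℝ)|)) ^ 3 * (‖f₂ a‖ + ‖f₂ (-a)‖ + ∫ x in (-a)..a, ‖f₃ x‖) := by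
  have hc₁ : Continuous f₁ := continuous_iff_continuousAt.2 fun x ↦ (h₁ x).continuousAt
  have hc₂ : Continuous f₂ := continuous_iff_continuousAt.2 fun x ↦ (h₂ x).continuousAt
  have hnorm1 : ‖(a / (π * I * n) : ℂ)‖ = a / (π * |(n : ℝ)|) := by
    rw [norm_div, Complex.norm_real, Real.norm_of_nonneg ha.le, norm_mul, norm_mul, Complex.norm_real,
      Real.norm_of_nonneg Real.pi_pos.le, Complex.norm_I, mul_one, Complex.norm_intCast]
  have e₀ : Yoshida1992.fourierCoeff a n f = (a / (π * I * n)) * Yoshida1992.fourierCoeff a n f₁ := by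
    rw [fourierCoeff_eq_boundary_add_deriv ha.ne' hn h₀ hc₁, he₀, sub_self, mul_zero, zero_add]
  have e₁ : Yoshida1992.fourierCoeff a n f₁ = (a / (π * I * n)) * Yoshida1992.fourierCoeff a n f₂ := by
    rw [fourierCoeff_eq_boundary_add_deriv ha.ne' hn h₁ hc₂, he₁, sub_self, mul_zero, zero_add]
  have b₂ := norm_fourierCoeff_le_of_deriv ha hn h₂ hf₃
  rw [e₀, e₁, norm_mul, norm_mul, hnorm1, pow_succ, pow_succ, pow_one]
  have hq : 0 ≤ a / (π * |(n : ℝ)|) := by positivity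
  calc a / (π * |(n : ℝ)|) * (a / (π * |(n : ℝ)|) * ‖Yoshida1992.fourierCoeff a n f₂‖)
      ≤ a / (π * |(n : ℝ)|) * (a / (π * |(n : ℝ)|)
          * (a / (π * |(n : ℝ)|) * (‖f₂ a‖ + ‖f₂ (-a)‖ + ∫ x in (-a)..a, ‖f₃ x‖))) :=
        mul_le_mul_of_nonneg_left (mul_le_mul_of_nonneg_left b₂ hq) hq
    _ = _ := by ring

/-- **Summability from power decay**: `|c_n| ≤ C/|n|^{j+2}` for `n ≠ 0` ⟹ `Σ_n |n|^j |c_n| < ∞`. -/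
theorem summable_pow_mul_norm_of_le_div_pow {c : ℤ → ℂ} {C : ℝ} (j : ℕ)
    (hC : ∀ n : ℤ, n ≠ 0 → ‖c n‖ ≤ C / |(n : ℝ)| ^ (j + 2)) :
    Summable fun n : ℤ ↦ |(n : ℝ)| ^ j * ‖c n‖ := by
  have hs : Summable fun n : ℤ ↦ C * (1 / (n : ℝ) ^ 2) :=
    (Real.summable_one_div_int_pow.2 one_lt_two).mul_left C
  refine Summable.of_norm_bounded_eventually (hs.abs) ?_
  have hcof : ∀ᶠ n : ℤ in cofinite, n ≠ 0 := by
    simpa using (Set.finite_singleton (0 : ℤ)).eventually_cofinite_notMem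
  filter_upwards [hcof] with n hn
  have hn' : 0 < |(n : ℝ)| := abs_pos.2 (by exact_mod_cast hn)
  rw [Real.norm_of_nonneg (by positivity)]
  calc |(n : ℝ)| ^ j * ‖c n‖ ≤ |(n : ℝ)| ^ j * (C / |(n : ℝ)| ^ (j + 2)) :=
        mul_le_mul_of_nonneg_left (hC n hn) (by positivity)
    _ = C * (1 / (n : ℝ) ^ 2) := by
        rw [pow_add, ← sq_abs (n : ℝ)]
        field_simp
    _ ≤ |C * (1 / (n : ℝ) ^ 2)| := le_abs_self _

/-- **The two summabilities of the dictionary** for a window with two matching boundary data: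
`Σ|c_n(f)| < ∞` and `Σ|n|·|c_n(f)| < ∞`. -/
theorem summable_norm_fourierCoeff_of_C1_periodising (ha : 0 < a) {f f₁ f₂ f₃ : ℝ → ℂ}
    (h₀ : ∀ x, HasDerivAt f (f₁ x) x) (h₁ : ∀ x, HasDerivAt f₁ (f₂ x) x) (h₂ : ∀ x, HasDerivAt f₂ (f₃ x) x)
    (hf₃ : Continuous f₃) (he₀ : f (-a) = f a) (he₁ : f₁ (-a) = f₁ a) :
    (Summable fun n : ℤ ↦ ‖Yoshida1992.fourierCoeff a n f‖)
      ∧ Summable fun n : ℤ ↦ |(n : ℝ)| ^ 1 * ‖Yoshida1992.fourierCoeff a n f‖ := by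
  set K : ℝ := ‖f₂ a‖ + ‖f₂ (-a)‖ + ∫ x in (-a)..a, ‖f₃ x‖ with hK
  have hb : ∀ j : ℕ, j ≤ 1 → ∀ n : ℤ, n ≠ 0 →
      ‖Yoshida1992.fourierCoeff a n f‖ ≤ ((a / π) ^ 3 * K) / |(n : ℝ)| ^ (j + 2) := by
    intro j hj n hn
    have hn1 : 1 ≤ |(n : ℝ)| := by
      rw [← Int.cast_abs]
      exact_mod_cast Int.one_le_abs hn
    have hK0 : 0 ≤ K := by
      have : 0 ≤ ∫ x in (-a)..a, ‖f₃ x‖ := intervalIntegral.integral_nonneg (by linarith) fun x _ ↦ norm_nonneg _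
      positivity
    calc ‖Yoshida1992.fourierCoeff a n f‖ ≤ (a / (π * |(n : ℝ)|)) ^ 3 * K :=
          norm_fourierCoeff_le_cube ha hn h₀ h₁ h₂ hf₃ he₀ he₁
      _ = ((a / π) ^ 3 * K) / |(n : ℝ)| ^ 3 := by
          rw [div_mul_eq_div_div, div_pow]
          ring
      _ ≤ ((a / π) ^ 3 * K) / |(n : ℝ)| ^ (j + 2) := by
          apply div_le_div_of_nonneg_left (by positivity) (by positivity)
          exact pow_le_pow_right₀ hn1 (by omega)
  refine ⟨?_, summable_pow_mul_norm_of_le_div_pow 1 (hb 1 le_rfl)⟩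
  simpa using summable_pow_mul_norm_of_le_div_pow 0 (hb 0 (by norm_num))


/-! ## The closed-form coefficients of the monomial windows in the tree's convention -/

/-- **Window coefficients of the monomials, closed form** (bridge to `WeilFormatCPolyFourier`): for `a ≠ 0`, `n ≠ 0`,
`c_n(x^q) = ∫_{−a}^{a} x^q e^{−iπnx/a} dx = (−1)^n Σ_{k≤q} (−1)^k q^{(k)} (a^{q−k} − (−a)^{q−k}) / (iω_{−n})^{k+1}`, `ω_m = πm/a`. -/
theorem fourierCoeff_ofReal_pow_eq_sum (ha : a ≠ 0) {n : ℤ} (hn : n ≠ 0) (q : ℕ) :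
    Yoshida1992.fourierCoeff a n (fun x : ℝ ↦ ((x : ℂ)) ^ q)
      = (-1 : ℂ) ^ n * ∑ k ∈ Finset.range (q + 1), (-1 : ℂ) ^ k * (q.descFactorial k : ℂ)
          * (((a : ℂ)) ^ (q - k) - (((-a : ℝ) : ℂ)) ^ (q - k)) / (I * (π * ((-n : ℤ) : ℝ) / a : ℝ)) ^ (k + 1) := by
  have e : Yoshida1992.fourierCoeff a n (fun x : ℝ ↦ ((x : ℂ)) ^ q)
      = ∫ x in (-a)..a, ((x : ℂ)) ^ q * Complex.exp (I * (π * ((-n : ℤ) : ℝ) / a : ℝ) * x) := by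
    unfold Yoshida1992.fourierCoeff
    refine intervalIntegral.integral_congr fun x _ ↦ ?_
    congr 2
    push_cast
    ring
  rw [e, integral_window_pow_mul_cexp_eq_sum ha (neg_ne_zero.2 hn) q, zpow_neg, ← inv_zpow, inv_neg, inv_one]

end Summit.RiemannHypothesis.RiemannHypothesis.Theorems.WeilFormatC

end
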